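import Literature.MathematicalPhysics.QuantumFieldTheory.LatticeGaugeDobrushinPoincare
import Literature.MathematicalPhysics.QuantumFieldTheory.THooftRegimeThresholds
import Mathlib.Analysis.CStarAlgebra.Matrix
import HarnessLib

/-!
# Shen–Zhu–Zhu's log-Sobolev and Poincaré inequalities for 't Hooft-scaled `SU(N)` lattice
# Yang–Mills (CMP 400 (2023) 805–851, Theorem 1.4 / Corollary 4.5), Lipschitz form

Shen–Zhu–Zhu prove (arXiv:2204.12737v1 p. 6, Theorem 1.4 = Corollary 4.5 for every tight limit
`μ_{N,β}` of the periodic finite-volume measures, p. 20, (4.12)–(4.13)): under Assumption 1.1,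
`K_S = (N+2)/2 - 1 - 8N|β|(d-1) > 0` (`G = SU(N)`), for all smooth cylinder functions `F` with
`μ(F²) = 1`,

  `μ(F² log F²) ≤ (2/K_S) ∑_{e ∈ E⁺} μ(|∇_e F|²)`   (1.9)/(4.12),   and
  `μ(F²) ≤ (1/K_S) ∑_{e} μ(|∇_e F|²) + μ(F)²`       (1.10)/(4.13),

where `∇_e` is the Riemannian gradient in the link variable `Q_e ∈ SU(N)` for the bi-invariant metric
induced by the Hilbert–Schmidt inner product `⟨X,Y⟩ = Re Tr(X Y^*)` (§2, p. 10–11; `|XQ|² = Tr(XX^*)`).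
This is the "FI currency" (full-measure functional inequality) baseline `β < 1/(16(d-1))`.

This file vendors the statement as a named fact in **Lipschitz form**: since SZZ's Riemannian metric
is the one induced by the Frobenius embedding `SU(N) ⊆ M_N(ℂ)` and chords are shorter than arcs, a
smooth cylinder function that is `L_e`-Lipschitz in the link `e` for the Frobenius distance
(`suFrobDist`) has `|∇_e F| ≤ L_e` pointwise, so (4.12)–(4.13) give
`Ent_μ(F²) ≤ (2/K_S) ∑_e L_e²` and `Var_μ(F) ≤ (1/K_S) ∑_e L_e²` (homogeneous form of (1.9) by
scaling). This consequence is what `shenZhuZhu_functionalInequalities` states, for every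
infinite-volume limit point of the torus Wilson states at tree coupling `Nβ`
(`infiniteVolumeLimitPoints`, = SZZ's tight limits `μ_{N,β}` of the periodic measures), with
`K_S = szzBakryEmeryConstSU N d β` (`THooftRegimeThresholds`). Cylinder functions are rendered as
`F(U) = f((U_e)_{e ∈ Λ})` with `f` the restriction of a `C^∞` function of the ambient matrices
(SZZ's `C^∞_cyl`, (1.8); smooth functions on the embedded compact submanifold `SU(N)^Λ` are such
restrictions), `matrixCylinder`.

Not here: the proof (the tree proves the ONE-link Poincaré inequality `SUNBakryEmery.haarPoincare_SU`
and the Dobrushin-route clustering `shen_zhu_zhu_holds`, not the multi-link Bakry–Émery LSI); the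
`SO(N)` case; the gradient form with `μ(|∇_e F|²)` on the right (needs the product-manifold Dirichlet
form, SZZ (3.7)/(3.12)).

## References

* H. Shen, R. Zhu, X. Zhu, CMP 400 (2023) 805–851 = arXiv:2204.12737v1: (1.8) p. 6, Theorem 1.4 with
  (1.9)–(1.10) p. 6, Corollary 4.4 (4.11) p. 19, Corollary 4.5 (4.12)–(4.13) p. 20, Remark 4.6 p. 20,
  §2 (Hilbert–Schmidt metric) p. 10–11 [ShenZhuZhuCMP2023].
-/

noncomputable section

open MeasureTheory ProbabilityTheory
open scoped Matrix.Norms.Frobenius ContDiff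
open Literature.MathematicalPhysics.QuantumLattice

namespace Literature.MathematicalPhysics.QuantumFieldTheory

variable {d N : ℕ}

/-- The cylinder observable `F(U) = f((U_e)_{e ∈ Λ})` on `SU(N)` lattice gauge configurations
obtained from a function `f` of the link matrices over the finite edge set `Λ` (plumbing for
Shen–Zhu–Zhu's `C^∞_cyl`, (1.8)). [cite: ShenZhuZhuCMP2023, (1.8)] -/
def matrixCylinder (Λ : Finset (ZdEdge d)) (f : (↥Λ → Matrix (Fin N) (Fin N) ℂ) → ℝ) :
    LGConfig d (Matrix.specialUnitaryGroup (Fin N) ℂ) → ℝ :=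
  fun U => f fun e => (U e : Matrix (Fin N) (Fin N) ℂ)

/-- Unfolding `matrixCylinder` (SZZ's cylinder functions `C^∞_cyl`, (1.8)). [cite: ShenZhuZhuCMP2023, (1.8)] -/
@[simp] theorem matrixCylinder_apply (Λ : Finset (ZdEdge d))
    (f : (↥Λ → Matrix (Fin N) (Fin N) ℂ) → ℝ) (U : LGConfig d (Matrix.specialUnitaryGroup (Fin N) ℂ)) :
    matrixCylinder Λ f U = f fun e => (U e : Matrix (Fin N) (Fin N) ℂ) := rfl

/-- A `matrixCylinder` over `Λ` is a cylinder observable with support `Λ` (A9 `IsCylinder`; SZZ (1.8):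
`F = f(Q_{e_1}, …, Q_{e_n})` depends on finitely many edges). [cite: ShenZhuZhuCMP2023, (1.8)] -/
theorem isCylinder_matrixCylinder (Λ : Finset (ZdEdge d))
    (f : (↥Λ → Matrix (Fin N) (Fin N) ℂ) → ℝ) : IsCylinder (matrixCylinder Λ f) Λ := by
  intro U V hUV
  simp only [matrixCylinder]
  congr 1
  funext e
  rw [hUV e e.2]

variable (d N) in
/-- **Shen–Zhu–Zhu, log-Sobolev and Poincaré inequalities for `SU(N)` lattice Yang–Mills at strong
coupling, Lipschitz form** (CMP 400 (2023) 805, Theorem 1.4 / Corollary 4.5, (1.9)–(1.10) =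
(4.12)–(4.13)). Let `d ≥ 2`, `N ≥ 1`, `|β| < 1/(16(d-1))` ('t Hooft coupling; Assumption 1.1, i.e.
`K_S := (N+2)/2 - 1 - 8N|β|(d-1) > 0`), and let `μ` be any infinite-volume limit point of the periodic
(torus) `SU(N)` Wilson states at tree coupling `Nβ` (SZZ's tight limits `μ_{N,β}`; by their Theorem 1.2
there is exactly one). Then for every finite edge set `Λ`, every `C^∞` function `f` of the link
matrices over `Λ` and constants `L_e ≥ 0` such that `f` restricted to `SU(N)^Λ` is `L_e`-Lipschitz in
the link `e` for the Frobenius distance (all other links fixed), the cylinder observable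
`F = f((U_e)_{e∈Λ})` satisfies
`Ent_μ(F²) := μ(F² log F²) - μ(F²) log μ(F²) ≤ (2/K_S) ∑_{e∈Λ} L_e²` and
`Var_μ(F) ≤ (1/K_S) ∑_{e∈Λ} L_e²`.
Printed form: "for all cylinder functions `F ∈ C^∞_cyl(Q)` with `μ(F²) = 1`,
`μ(F² log F²) ≤ (2/K_S) ∑_{e∈E⁺} μ(|∇_e F|²)` (1.9). This implies the Poincaré inequality, i.e. for
all cylinder functions `F ∈ C^∞_cyl(Q)`, `μ(F²) ≤ (1/K_S) ∑_{e∈E⁺} μ(|∇_e F|²) + μ(F)²` (1.10)";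
the Lipschitz form follows because `|∇_e F| ≤ L_e` for SZZ's Hilbert–Schmidt metric (§2), and the
homogeneous entropy form by scaling. [cite: ShenZhuZhuCMP2023, Theorem 1.4] -/
def shenZhuZhu_functionalInequalities : Prop :=
  ∀ (hd : 2 ≤ d) (hN : 1 ≤ N) (β : ℝ), |β| < szzThresholdSU d →
    ∀ μ ∈ infiniteVolumeLimitPoints (d := d) (fundamentalRep (Fin N)) ((N : ℝ) * β),
    ∀ (Λ : Finset (ZdEdge d)) (f : (↥Λ → Matrix (Fin N) (Fin N) ℂ) → ℝ) (L : ↥Λ → ℝ),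
      ContDiff ℝ ∞ f → (∀ e, 0 ≤ L e) →
      (∀ (e : ↥Λ) (M M' : ↥Λ → Matrix.specialUnitaryGroup (Fin N) ℂ),
        (∀ e', e' ≠ e → M e' = M' e') →
          |f (fun e' => (M e' : Matrix (Fin N) (Fin N) ℂ)) -
              f (fun e' => (M' e' : Matrix (Fin N) (Fin N) ℂ))| ≤ L e * suFrobDist (M e) (M' e)) →
      (∫ U, matrixCylinder Λ f U ^ 2 * Real.log (matrixCylinder Λ f U ^ 2) ∂μ -
          (∫ U, matrixCylinder Λ f U ^ 2 ∂μ) * Real.log (∫ U, matrixCylinder Λ f U ^ 2 ∂μ)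
            ≤ 2 / szzBakryEmeryConstSU N d β * ∑ e, L e ^ 2) ∧
      (Var[matrixCylinder Λ f; μ] ≤ 1 / szzBakryEmeryConstSU N d β * ∑ e, L e ^ 2)

/-- The constant in `shenZhuZhu_functionalInequalities` is positive in its regime: for `d ≥ 2`,
`N ≥ 1` and `|β| < 1/(16(d-1))`, `0 < K_S` (SZZ: "Assumption 1.1 is equivalent to (1.3)").
[cite: ShenZhuZhuCMP2023, (1.3)] -/
theorem shenZhuZhu_functionalInequalities.const_pos (hd : 2 ≤ d) (hN : 1 ≤ N) {β : ℝ}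
    (hβ : |β| < szzThresholdSU d) : 0 < szzBakryEmeryConstSU N d β :=
  (szzBakryEmeryConstSU_pos_iff hd hN β).2 hβ

/-- **Corollary (spectral-gap form for one-link Lipschitz observables).** Under
`shenZhuZhu_functionalInequalities d N`, in its regime, an observable depending on a single link `e₀`
through an `M`-Lipschitz (Frobenius) smooth function of the matrix has variance at most `M²/K_S` under
every infinite-volume limit state — the `|Λ| = 1` instance (cf. SZZ Cor. 4.7, where `f = ⟨Q_{e₀}, E⟩`
gives `Var ≤ γ/K_S`). [cite: ShenZhuZhuCMP2023, Corollary 4.7] -/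
theorem shenZhuZhu_functionalInequalities.variance_single_link
    (h : shenZhuZhu_functionalInequalities d N) (hd : 2 ≤ d) (hN : 1 ≤ N) {β : ℝ}
    (hβ : |β| < szzThresholdSU d) {μ : Measure (LGConfig d (Matrix.specialUnitaryGroup (Fin N) ℂ))}
    (hμ : μ ∈ infiniteVolumeLimitPoints (d := d) (fundamentalRep (Fin N)) ((N : ℝ) * β))
    (e₀ : ZdEdge d) (g : Matrix (Fin N) (Fin N) ℂ → ℝ) (hg : ContDiff ℝ ∞ g) {M : ℝ} (hM : 0 ≤ M)
    (hLip : ∀ a b : Matrix.specialUnitaryGroup (Fin N) ℂ,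
      |g (a : Matrix (Fin N) (Fin N) ℂ) - g (b : Matrix (Fin N) (Fin N) ℂ)| ≤ M * suFrobDist a b) :
    Var[matrixCylinder ({e₀} : Finset (ZdEdge d))
        (fun m => g (m ⟨e₀, Finset.mem_singleton_self e₀⟩)); μ] ≤
      1 / szzBakryEmeryConstSU N d β * M ^ 2 := by
  classical
  set Λ : Finset (ZdEdge d) := {e₀} with hΛ
  set f : (↥Λ → Matrix (Fin N) (Fin N) ℂ) → ℝ := fun m => g (m ⟨e₀, Finset.mem_singleton_self e₀⟩)
    with hf
  have hfC : ContDiff ℝ ∞ f :=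
    hg.comp (contDiff_apply ℝ (Matrix (Fin N) (Fin N) ℂ) (⟨e₀, Finset.mem_singleton_self e₀⟩ : ↥Λ))
  have hfL : ∀ (e : ↥Λ) (Mv Mv' : ↥Λ → Matrix.specialUnitaryGroup (Fin N) ℂ),
      (∀ e', e' ≠ e → Mv e' = Mv' e') →
        |f (fun e' => (Mv e' : Matrix (Fin N) (Fin N) ℂ)) -
            f (fun e' => (Mv' e' : Matrix (Fin N) (Fin N) ℂ))| ≤ (fun _ => M) e * suFrobDist (Mv e) (Mv' e) := by
    intro e Mv Mv' _
    have he : e = ⟨e₀, Finset.mem_singleton_self e₀⟩ := Subsingleton.elim _ _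
    subst he
    simpa [hf] using hLip (Mv ⟨e₀, Finset.mem_singleton_self e₀⟩) (Mv' ⟨e₀, Finset.mem_singleton_self e₀⟩)
  have := (h hd hN β hβ μ hμ Λ f (fun _ => M) hfC (fun _ => hM) hfL).2
  simpa [hΛ] using this

end Literature.MathematicalPhysics.QuantumFieldTheory
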